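import Summits.BirchSwinnertonDyer.BirchSwinnertonDyer.Theorems.AlignedTransportAtTwoMainConjectureOfRankZeroBSDAtTwoSelmerLayerModel
import Summits.BirchSwinnertonDyer.BirchSwinnertonDyer.Theorems.AlignedTransportAtTwoMainConjectureOfRankZeroBSDAtTwoTwistReadingLayerOne
import HarnessLib

/-!
# Route `AlignedTransportAtTwo`, crux C2 `MainConjectureOfRankZeroBSDAtTwo` (stmt-BirchSwinnertonDyer-22298):
# THE FIRST LAYER OF THE CONTROL THEOREM IS THE TWIST — `corank_{ℤ₂} (W.selmerLayer κ 1) = corank Sel_{2^∞}(W/ℚ) + corank Sel_{2^∞}(W⁽²⁾/ℚ)`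
# for the cyclotomic `ℤ₂`-extension, i.e. g38's layer-one reading (`…TwistReadingLayerOne`) transported to the `Γ_ℚ`-INTERNAL layer Selmer
# group `W.selmerLayer κ 1 ⊆ H¹(κ⁻¹(2ℤ₂), E[2^∞])` — the object of Mazur's control theorem `selmer_control`, of Greenberg's Lemma 3.1
# (`finite_ker_layerToInfty`) and of the lineage's layer program — through g39's model identification (`…SelmerLayerModel`)

HONEST FRAMING (cell `bsd-f1-sign2`, WIDTH-5 attached prover seat `bsd-line-att-p5` gen 39 on line `birth` of the lead `bsd-line-att-p2`;
`--supports` stmt-BirchSwinnertonDyer-22298, closes nothing; BSD is NOT proved by any of this; the crux C2, its verdict «blocked-on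
`Rank1Residual.GreenbergMuConjectureIrreducible`» and every registered stub are untouched). THEOREMS ONLY — no `def`, no instance, no named
fact, no `sorry`. PRINT binders exactly as in `…TwistReadingLayerOne` (`h17` Kato 17.4 (1)(2) at `2`; `hGZK`; the two-bit-row binders in §4);
the number-field structure of `ℚ_1 = κ.layer 1` is the tree's instance `ZpExtension.numberField_layer` (no binder needed any more).

* §1 (any elliptic `W/ℚ`, `κ` cyclotomic; NO named fact) ★★ `zpCorank_selmerLayer_one_eq_add` —
  **`corank_{ℤ₂} (W.selmerLayer κ 1) = corank_{ℤ₂} Sel_{2^∞}(W/ℚ) + corank_{ℤ₂} Sel_{2^∞}(W⁽²⁾/ℚ)`** (Dokchitser–Dokchitser 4.14 at `ℚ_1 = ℚ(√2)`,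
  tree theorem `selmerCorank_baseChange_eq_add`, read `Γ_ℚ`-internally); model form `…_of_model`.
* §2 (good ordinary `W`, PRINT `h17`) ★★ `zpCorank_selmerLayer_one_le_add_orderAtNegTwo` — **`corank_{ℤ₂} (W.selmerLayer κ 1) ≤ corank Sel_{2^∞}(W/ℚ) + ord_{T=−2} L₂(W,T)`**:
  the control-theorem side of the first layer is bounded by the `2`-adic `L`-function at the order-`2` character.
* §3 THE ROAD: ★★ `zpCorank_selmerLayer_one_le_one_of_road` (`a₂ = +1`: `≤ 1`), ★ `…_eq_one_of_road_of_parity` (`= 1` with `2`-parity for a model of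
  `W⁽²⁾`), ★ `…_le_three_of_road_of_frobeniusTrace_eq_neg_one` (`a₂ = −1`: `≤ 3`), ★ `…_le_four_of_unitSymbol`.
* §4 ★★ `lambda_mu_mem_of_road_ord_three_of_zpCorank_selmerLayer_one` — the `j`-BIT DOOR on the `ord₋₂ = 3` row with the certificate
  **`corank_{ℤ₂} (W.selmerLayer κ 1) ≥ 3 ⟹ (λ, μ) ∈ {(λ₂, 0), (3, 1)}`** — the certificate now lives in the SAME group as the control theorem's
  `s_1 : Sel_{2^∞}(E/ℚ_1) → Sel_{2^∞}(E/ℚ_∞)^{Γ_1}`.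

References: T. and V. Dokchitser, Ann. of Math. 172 (2010), Lemma 4.14 [DokchitserDokchitserAnnals2010]; R. Greenberg, LNM 1716 (1999), §1 Thm. 1.2,
§2, §3 Lemma 3.1, §4 p. 107 [GreenbergLNM1716]; K. Kato, Astérisque 295 (2004), Thm. 17.4 [Kato2004Asterisque]; B. Mazur, Invent. Math. 18 (1972) §6
[Mazur1972]; L. Washington, GTM 83, §13.1 [Washington1997].
-/

set_option linter.dupNamespace false
set_option autoImplicit false

noncomputable section

open scoped Classical MatrixGroups ModularForm

namespace Summit.BirchSwinnertonDyer.BirchSwinnertonDyer.Theorems.AlignedTransportAtTwoSelmerLayerModelAtTwo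

open PowerSeries CongruenceSubgroup WeierstrassCurve Literature.NumberTheory.EllipticCurves
  Literature.NumberTheory.EllipticCurves.ModularForms
  Literature.NumberTheory.EllipticCurves.Rank1Residual
  Literature.NumberTheory.EllipticCurves.Rank1Residual.Typed
  Literature.NumberTheory.EllipticCurves.Greenberg1999
  Summit.BirchSwinnertonDyer.Rank1Residual
  Summit.BirchSwinnertonDyer.Rank1Residual.X1.MuLambda
  Summit.BirchSwinnertonDyer.Rank1Residual.F1Sign2
  Summit.BirchSwinnertonDyer.BirchSwinnertonDyer.Theorems.Rank1ResidualX1Defs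
  Summit.BirchSwinnertonDyer.BirchSwinnertonDyer.Theorems.AlignedTransportAtTwoTwoFixedPoints
  Summit.BirchSwinnertonDyer.BirchSwinnertonDyer.Theorems.AlignedTransportAtTwoRoadSecondFixedPoint
  Summit.BirchSwinnertonDyer.BirchSwinnertonDyer.Theorems.AlignedTransportAtTwoTwistReadingLayerOne
  Summit.BirchSwinnertonDyer.BirchSwinnertonDyer.Theorems.AlignedTransportAtTwoSelmerLayerModel

variable (W : WeierstrassCurve ℚ) [W.IsElliptic]

/-! ## §1 `corank_{ℤ₂} (W.selmerLayer κ 1) = corank Sel_{2^∞}(W/ℚ) + corank Sel_{2^∞}(W⁽²⁾/ℚ)` -/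

/-- ★★ **`corank_{ℤ₂} (W.selmerLayer κ 1) = corank_{ℤ₂} Sel_{2^∞}(W/ℚ) + corank_{ℤ₂} Sel_{2^∞}(W⁽²⁾/ℚ)`** for every elliptic `W/ℚ` and the cyclotomic
`ℤ₂`-extension `κ` (`ℚ_1 = ℚ(√2)`): the `Γ_ℚ`-internal first-layer Selmer group of the control theorem has the corank of `Sel_{2^∞}(W/ℚ_1)`
(g39 `selmerCorank_layer_eq_zpCorank_selmerLayer`) = the Dokchitser–Dokchitser sum (g38 `selmerCorank_layer_one_eq_add`). NO named fact.
[cite: DokchitserDokchitserAnnals2010, Lemma 4.14] [cite: GreenbergLNM1716, §2 and §3] [cite: Washington1997, §13.1] -/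
theorem zpCorank_selmerLayer_one_eq_add {κ : ZpExtension ℚ 2} (hκ : κ.IsCyclotomic) :
    zpCorank (W.selmerLayer κ 1) 2 = W.selmerCorank 2 + (W.quadraticTwist 2).selmerCorank 2 := by
  rw [← selmerCorank_layer_eq_zpCorank_selmerLayer W κ 1]
  exact selmerCorank_layer_one_eq_add W hκ

/-- The same with ANY `ℚ`-model `W₂` of `W⁽²⁾` (`V • W₂ = W^{(2)}`). [cite: DokchitserDokchitserAnnals2010, Lemma 4.14] -/
theorem zpCorank_selmerLayer_one_eq_add_of_model {κ : ZpExtension ℚ 2} (hκ : κ.IsCyclotomic) (W₂ : WeierstrassCurve ℚ) {V : VariableChange ℚ}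
    (hV : V • W₂ = W.quadraticTwist 2) :
    zpCorank (W.selmerLayer κ 1) 2 = W.selmerCorank 2 + W₂.selmerCorank 2 := by
  rw [← selmerCorank_layer_eq_zpCorank_selmerLayer W κ 1]
  exact selmerCorank_layer_one_eq_add_of_model W hκ W₂ hV

/-! ## §2 `corank_{ℤ₂} (W.selmerLayer κ 1) ≤ corank Sel_{2^∞}(W/ℚ) + ord_{T=−2} L₂(W,T)` -/

/-- ★★ **THE CONTROL-THEOREM SIDE OF THE FIRST LAYER IS BOUNDED BY THE `2`-ADIC `L`-FUNCTION AT THE ORDER-`2` CHARACTER.** `W/ℚ` globally minimal, good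
ordinary at `2`, `f` a newform of `W` with PRINT `h17`, `G` the integral lift of `L₂(f,α)` with `ord_{T=−2} G = n`, `κ` cyclotomic:
**`corank_{ℤ₂} (W.selmerLayer κ 1) ≤ corank_{ℤ₂} Sel_{2^∞}(W/ℚ) + n`** (g38 `selmerCorank_layer_one_le_add_orderAtNegTwo` transported).
[cite: Kato2004Asterisque, Thm. 17.4 (1)(2) (p. 273)] [cite: DokchitserDokchitserAnnals2010, Lemma 4.14] [cite: GreenbergLNM1716, §3 Lemma 3.1, §4 p. 107] -/
theorem zpCorank_selmerLayer_one_le_add_orderAtNegTwo [W.IsGloballyMinimal] {N : ℕ} [NeZero N] {f : CuspForm (Gamma0 N) 2}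
    (h17 : kato_divisibility_allPrimes W 2 (f := f)) (hord : IsOrdinaryAt W 2) (hf : IsNewformOf W f)
    {G : IwasawaAlgebra 2} (hG : iwasawaToPowerSeries 2 G = padicLFunction f (unitRoot W 2 : ℚ_[2])) {n : ℕ}
    (hn : HasOrderAtNegTwo G n) {κ : ZpExtension ℚ 2} (hκ : κ.IsCyclotomic) :
    zpCorank (W.selmerLayer κ 1) 2 ≤ W.selmerCorank 2 + n := by
  rw [← selmerCorank_layer_eq_zpCorank_selmerLayer W κ 1]
  exact selmerCorank_layer_one_le_add_orderAtNegTwo W h17 hord hf hG hn hκ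

/-! ## §3 The road, `Γ_ℚ`-internally -/

/-- ★★ **THE `a₂ = +1` ROAD: `corank_{ℤ₂} (W.selmerLayer κ 1) ≤ 1`** (hypotheses of g38's `selmerCorank_layer_one_le_one_of_road`: globally minimal, good ordinary at `2`,
`a₂ = +1`, `∏ c_v` odd, `Δ_min ≡ 3, 5 (mod 8)`, `r_an(W) = 0`, unit central symbol; PRINT `h17`, `hGZK`; `κ` cyclotomic).
[cite: Kato2004Asterisque, Thm. 17.4 (1)(2) (p. 273)] [cite: DokchitserDokchitserAnnals2010, Lemma 4.14] [cite: GreenbergLNM1716, §3 Lemma 3.1, §4 p. 107] -/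
theorem zpCorank_selmerLayer_one_le_one_of_road [W.IsGloballyMinimal] [NeZero (W.conductorNorm ℤ)] {f : CuspForm (Gamma0 (W.conductorNorm ℤ)) 2}
    (h17 : kato_divisibility_allPrimes W 2 (f := f)) (hGZK : rank_eq_analyticRank_of_analyticRank_le_one) (hord : IsOrdinaryAt W 2)
    (hf : IsNewformOf W f) (ha : W.frobeniusTrace 2 = 1) (hodd : Odd W.tamagawaProduct)
    (hΔ : minimalDiscriminantInt W % 8 = 3 ∨ minimalDiscriminantInt W % 8 = 5) (hr : W.analyticRank = 0)
    {G : IwasawaAlgebra 2} (hG : iwasawaToPowerSeries 2 G = padicLFunction f (unitRoot W 2 : ℚ_[2]))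
    (hsym : ‖(ratPlusSymbol f 0 : ℚ_[2])‖ = 1) {κ : ZpExtension ℚ 2} (hκ : κ.IsCyclotomic) :
    zpCorank (W.selmerLayer κ 1) 2 ≤ 1 := by
  rw [← selmerCorank_layer_eq_zpCorank_selmerLayer W κ 1]
  exact (selmerCorank_layer_one_le_one_of_road W h17 hGZK hord hf ha hodd hΔ hr hG hsym hκ).1

/-- ★ **`corank_{ℤ₂} (W.selmerLayer κ 1) = 1` EXACTLY** on the `a₂ = +1` road, given the PRINT `2`-parity theorem for a model `W₂` of the twist and `w(W₂) = −1`.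
[cite: DokchitserDokchitserAnnals2010, Thm. 1.4 and Lemma 4.14] [cite: Kato2004Asterisque, Thm. 17.4 (1)(2) (p. 273)] -/
theorem zpCorank_selmerLayer_one_eq_one_of_road_of_parity [W.IsGloballyMinimal] [NeZero (W.conductorNorm ℤ)]
    {f : CuspForm (Gamma0 (W.conductorNorm ℤ)) 2} (W₂ : WeierstrassCurve ℚ) [W₂.IsElliptic] {V : VariableChange ℚ} (hV : V • W₂ = W.quadraticTwist 2)
    (h17 : kato_divisibility_allPrimes W 2 (f := f)) (hDD : p_parity W₂ 2) (hw : W₂.rootNumber = -1)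
    (hGZK : rank_eq_analyticRank_of_analyticRank_le_one) (hord : IsOrdinaryAt W 2)
    (hf : IsNewformOf W f) (ha : W.frobeniusTrace 2 = 1) (hodd : Odd W.tamagawaProduct)
    (hΔ : minimalDiscriminantInt W % 8 = 3 ∨ minimalDiscriminantInt W % 8 = 5) (hr : W.analyticRank = 0)
    {G : IwasawaAlgebra 2} (hG : iwasawaToPowerSeries 2 G = padicLFunction f (unitRoot W 2 : ℚ_[2]))
    (hsym : ‖(ratPlusSymbol f 0 : ℚ_[2])‖ = 1) {κ : ZpExtension ℚ 2} (hκ : κ.IsCyclotomic) :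
    zpCorank (W.selmerLayer κ 1) 2 = 1 := by
  rw [← selmerCorank_layer_eq_zpCorank_selmerLayer W κ 1]
  exact (selmerCorank_layer_one_eq_one_of_road_of_parity W W₂ hV h17 hDD hw hGZK hord hf ha hodd hΔ hr hG hsym hκ).1

/-- ★ **The `a₂ = −1` road: `corank_{ℤ₂} (W.selmerLayer κ 1) ≤ 3`**, PRINT `h17` + `hGZK`.
[cite: Kato2004Asterisque, Thm. 17.4 (1)(2) (p. 273)] [cite: DokchitserDokchitserAnnals2010, Lemma 4.14] -/
theorem zpCorank_selmerLayer_one_le_three_of_road_of_frobeniusTrace_eq_neg_one [W.IsGloballyMinimal] [NeZero (W.conductorNorm ℤ)]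
    {f : CuspForm (Gamma0 (W.conductorNorm ℤ)) 2}
    (h17 : kato_divisibility_allPrimes W 2 (f := f)) (hGZK : rank_eq_analyticRank_of_analyticRank_le_one) (hord : IsOrdinaryAt W 2)
    (hf : IsNewformOf W f) (ha : W.frobeniusTrace 2 = -1) (hodd : Odd W.tamagawaProduct)
    (hΔ : minimalDiscriminantInt W % 8 = 3 ∨ minimalDiscriminantInt W % 8 = 5) (hr : W.analyticRank = 0)
    {G : IwasawaAlgebra 2} (hG : iwasawaToPowerSeries 2 G = padicLFunction f (unitRoot W 2 : ℚ_[2]))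
    (hsym : ‖(ratPlusSymbol f 0 : ℚ_[2])‖ = 1) {κ : ZpExtension ℚ 2} (hκ : κ.IsCyclotomic) :
    zpCorank (W.selmerLayer κ 1) 2 ≤ 3 := by
  rw [← selmerCorank_layer_eq_zpCorank_selmerLayer W κ 1]
  exact (selmerCorank_layer_one_le_three_of_road_of_frobeniusTrace_eq_neg_one W h17 hGZK hord hf ha hodd hΔ hr hG hsym hκ).1

/-- ★ **Unit central symbol, any good-ordinary `W` with `r_an(W) = 0`: `corank_{ℤ₂} (W.selmerLayer κ 1) ≤ 4`.** PRINT `h17` + `hGZK`.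
[cite: Kato2004Asterisque, Thm. 17.4 (1)(2) (p. 273)] [cite: MazurTateTeitelbaum1986Invent, §I.14] -/
theorem zpCorank_selmerLayer_one_le_four_of_unitSymbol [W.IsGloballyMinimal] [NeZero (W.conductorNorm ℤ)] {f : CuspForm (Gamma0 (W.conductorNorm ℤ)) 2}
    (h17 : kato_divisibility_allPrimes W 2 (f := f)) (hGZK : rank_eq_analyticRank_of_analyticRank_le_one) (hord : IsOrdinaryAt W 2)
    (hf : IsNewformOf W f) (hr : W.analyticRank = 0)
    {G : IwasawaAlgebra 2} (hG : iwasawaToPowerSeries 2 G = padicLFunction f (unitRoot W 2 : ℚ_[2]))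
    (hsym : ‖(ratPlusSymbol f 0 : ℚ_[2])‖ = 1) {κ : ZpExtension ℚ 2} (hκ : κ.IsCyclotomic) :
    zpCorank (W.selmerLayer κ 1) 2 ≤ 4 := by
  rw [← selmerCorank_layer_eq_zpCorank_selmerLayer W κ 1]
  exact selmerCorank_layer_one_le_four_of_unitSymbol W h17 hGZK hord hf hr hG hsym hκ

/-! ## §4 The `j`-bit door with a `Γ_ℚ`-internal certificate -/

/-- ★★ **`corank_{ℤ₂} (W.selmerLayer κ 1) ≥ 3 ⟹ (λ(X), μ(X)) ∈ {(λ₂, 0), (3, 1)}`** on the `a₂ = −1`, `ord₋₂ L₂ = 3` row (hypotheses of g38's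
`lambda_mu_mem_of_road_ord_three_of_selmerCorank_layer_one`; the certificate is now stated on the `Γ_ℚ`-internal first-layer Selmer group, the source
of the control map `s_1 : Sel_{2^∞}(E/ℚ_1) → Sel_{2^∞}(E/ℚ_∞)^{Γ_1}`). [cite: Kato2004Asterisque, Thm. 17.4 (1)(2) (p. 273)] [cite: DokchitserDokchitserAnnals2010, Lemma 4.14]
[cite: GreenbergLNM1716, §3 Lemma 3.1, §4 p. 107, §5 pp. 176–178] -/
theorem lambda_mu_mem_of_road_ord_three_of_zpCorank_selmerLayer_one [W.IsGloballyMinimal] [NeZero (W.conductorNorm ℤ)]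
    {f : CuspForm (Gamma0 (W.conductorNorm ℤ)) 2}
    (h17 : kato_divisibility_allPrimes W 2 (f := f)) (h64 : matsuno2008_prop64_lambda_parity_two)
    (hGr : Greenberg1999.thm41_charValue_rankZero_anyPrime) (hper : realPeriodRat_eq_unit_mul_plusPeriod_two)
    (hGZK : rank_eq_analyticRank_of_analyticRank_le_one) (hord : IsOrdinaryAt W 2)
    (ht : ∀ x : ℚ, ¬ HasRationalTwoTorsionX W x) (hr : W.analyticRank = 0) (hbsd : BSDp W 2) (hf : IsNewformOf W f)
    (ha : W.frobeniusTrace 2 = -1) (hodd : Odd W.tamagawaProduct)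
    (hΔ : minimalDiscriminantInt W % 8 = 3 ∨ minimalDiscriminantInt W % 8 = 5)
    {G : IwasawaAlgebra 2} (hG : iwasawaToPowerSeries 2 G = padicLFunction f (unitRoot W 2 : ℚ_[2])) (hred : red G ≠ 0)
    (h3 : HasOrderAtNegTwo G 3) (hsym : ‖(ratPlusSymbol f 0 : ℚ_[2])‖ = 1)
    {κ : ZpExtension ℚ 2} {γ : Field.absoluteGaloisGroup ℚ} (hκ : κ.IsCyclotomic)
    (hγ : κ.IsTopGenerator γ) (hγ' : IsCyclotomicVariable 2 γ) (D : W.SelmerDualData κ γ) (hs : 3 ≤ zpCorank (W.selmerLayer κ 1) 2) :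
    (D.lambda = lam G ∧ D.mu = 0) ∨ (D.lambda = 3 ∧ D.mu = 1) := by
  rw [← selmerCorank_layer_eq_zpCorank_selmerLayer W κ 1] at hs
  exact lambda_mu_mem_of_road_ord_three_of_selmerCorank_layer_one W h17 h64 hGr hper hGZK hord ht hr hbsd hf ha hodd hΔ hG hred h3 hsym
    hκ hγ hγ' D hs

end Summit.BirchSwinnertonDyer.BirchSwinnertonDyer.Theorems.AlignedTransportAtTwoSelmerLayerModelAtTwo

end
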